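import Summits.Ventures.CertifiedManyBodySolver.Rows.TorusCeilingHomSpinTwist
import HarnessLib

/-!
# Spin-twisted torus ceiling V — the `L × ⋯ × L` torus as a hom carrier (`coordHom`), every twist

HONEST FRAMING: first certified bounds; not a superconductivity verdict; every number certified or
labelled float.
The coordinate reduction `ℤ^d →+ (ℤ/L)^d` (the Mathlib term `(Int.castAddHom (ZMod L)).compLeft (Fin d)`,
`coordHom` in lemma names; no new definition) presents the periodic `L^d` torus in the hom
framework of Parts I–IV (`HomTorusModel` … `TorusCeilingHomSpinTwist`): its signed hops `±eᵢ` are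
non-degenerate for `L ≥ 3` and it is injective on every window of coordinate spreads `≤ L − 1`.
Consequence (`coordSpinTwist_minEnergyOn_div_ge_of_window_certificate`): a translation + EOM window
certificate of support `≤ L × L` bounds the energy density of the `L × L` Hubbard torus with EVERY
boundary twist — one `U(1)` phase per direction AND per species (`κ : Fin 2 → Fin 2 → U(1)`: PP, AP,
AA, any two-direction flux, any spin twist `θ↑ ≠ θ↓`) — in every sector `(2n, S^z = 0)`.  This closes
the square-torus items left open by `Rows/TorusCeilingFlux.lean` (one seam, direction `0` only):
two-direction (`AA`, `(θx, θy)`) fluxes and spin-dependent twists of `3 × 3` and `4 × 4`, the kernel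
form of the CAL cap rows `CAP(≤3,≤3)` / `CAP(4,4)` with twists (cal-3 P-CAL-2).
[cite: ShastrySutherland1990] [cite: Han2020Bootstrap, §3] [cite: Lieb1994, eq. (1)]
-/

noncomputable section

open Matrix Finset
open Literature.MathematicalPhysics.QuantumLattice
open Literature.MathematicalPhysics.QuantumFieldTheory hiding Site
open Literature.MathematicalPhysics.QuantumManyBody.StateRelaxation
open Literature.Probability.LatticeModels
open HubbardWave0
open scoped ComplexOrder ComplexConjugate

namespace Summit.Ventures.CertifiedManyBodySolver.Rows

section CoordHom

variable {d N : ℕ}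

/-! `coordHom d N` below is NOT a new definition: it is the Mathlib term
`(Int.castAddHom (ZMod N)).compLeft (Fin d) : (Fin d → ℤ) →+ (Fin d → ZMod N)`, i.e. the coordinate
reduction `ℤ^d →+ (ℤ/N)^d`, `x ↦ (xᵢ mod N)ᵢ` — the periodic `N^d` torus as a hom carrier (`Site d` and
`TorusSite d N` are reducible). -/

/-- `coordHom d N x i = xᵢ mod N` (definitional). [folklore] -/
theorem coordHom_apply (x : Site d) (i : Fin d) :
    (Int.castAddHom (ZMod N)).compLeft (Fin d) x i = ((x i : ℤ) : ZMod N) := rfl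

/-- The hops of `coordHom`: `eᵢ ↦ eᵢ mod N`. [folklore] -/
theorem coordHom_unitVec (i : Fin d) :
    (Int.castAddHom (ZMod N)).compLeft (Fin d) (unitVec i) = Pi.single i (1 : ZMod N) := by
  funext j
  rw [coordHom_apply]
  by_cases h : j = i
  · subst h
    rw [show unitVec j j = 1 from Pi.single_eq_same _ _, Pi.single_eq_same, Int.cast_one]
  · rw [show unitVec i j = 0 from Pi.single_eq_of_ne h _, Pi.single_eq_of_ne h, Int.cast_zero]

/-- The signed hops of `coordHom` are `±eᵢ mod N`. [folklore] -/
theorem signedHop_coordHom (q : Fin d × Bool) :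
    signedHop ((Int.castAddHom (ZMod N)).compLeft (Fin d)) q =
      bif q.2 then Pi.single q.1 (1 : ZMod N) else -Pi.single q.1 (1 : ZMod N) := by
  unfold signedHop
  rw [coordHom_unitVec]

/-- **Non-degenerate hops of the `N^d` torus**: for `N ≥ 3` the `2d` signed hops `±eᵢ mod N` are
pairwise distinct. [folklore] -/
theorem injective_signedHop_coordHom (hN : 3 ≤ N) :
    Function.Injective (signedHop ((Int.castAddHom (ZMod N)).compLeft (Fin d))) := by
  have h1m : (1 : ZMod N) ≠ -1 := fun h => by
    have h' : ((1 : ℤ) : ZMod N) = ((-1 : ℤ) : ZMod N) := by push_cast; exact h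
    rw [ZMod.intCast_eq_intCast_iff_dvd_sub] at h'
    have h2 : (N : ℤ) ∣ 2 := by
      rw [show (-1 : ℤ) - 1 = -2 by norm_num, dvd_neg] at h'
      exact h'
    have := Int.le_of_dvd (by norm_num) h2
    omega
  have h10 : (1 : ZMod N) ≠ 0 := fun h => by
    have h' : ((1 : ℤ) : ZMod N) = ((0 : ℤ) : ZMod N) := by push_cast; exact h
    rw [ZMod.intCast_eq_intCast_iff_dvd_sub] at h'
    have h2 : (N : ℤ) ∣ 1 := by
      rw [zero_sub, dvd_neg] at h'
      exact h'
    have := Int.le_of_dvd (by norm_num) h2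
    omega
  rintro ⟨i, b⟩ ⟨j, c⟩ h
  rw [signedHop_coordHom, signedHop_coordHom] at h
  dsimp only at h
  have hi := congrFun h i
  by_cases hij : i = j
  · subst hij
    cases b <;> cases c
    · rfl
    · exfalso
      simp only [cond_false, cond_true, Pi.neg_apply, Pi.single_eq_same] at hi
      exact h1m hi.symm
    · exfalso
      simp only [cond_false, cond_true, Pi.neg_apply, Pi.single_eq_same] at hi
      exact h1m hi
    · rfl
  · exfalso
    cases b <;> cases c <;>
      simp only [cond_false, cond_true, Pi.neg_apply, Pi.single_eq_same, Pi.single_eq_of_ne hij,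
        neg_zero, neg_eq_zero] at hi
    all_goals exact h10 hi

/-- **Injectivity of `coordHom` on a window from coordinate spreads**: if every coordinate spread of
`S ⊆ ℤ^d` is at most `M` and `M + 1 ≤ N`, then `x ↦ x mod N` is injective on `S`. [folklore] -/
theorem injOn_coordHom_of_spread {M : ℕ} (hM : M + 1 ≤ N) {S : Finset (Site d)}
    (hspread : ∀ x ∈ S, ∀ y ∈ S, ∀ i, |x i - y i| ≤ (M : ℤ)) :
    Set.InjOn ((Int.castAddHom (ZMod N)).compLeft (Fin d)) ↑S := by
  intro x hx y hy hxy
  funext i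
  have h := congrFun hxy i
  rw [coordHom_apply, coordHom_apply, ZMod.intCast_eq_intCast_iff_dvd_sub] at h
  have hs := hspread x hx y hy i
  have hlt : |y i - x i| < (N : ℤ) := by
    rw [abs_sub_comm]
    exact lt_of_le_of_lt hs (by exact_mod_cast hM)
  have h0 := Int.eq_zero_of_abs_lt_dvd h hlt
  omega

end CoordHom

section CoordSpinTwist

/-! ### The `L × L` torus with every `U(1)↑ × U(1)↓` boundary twist -/

/-- **Spin-twisted `L × L` torus, every twist.** For `L ≥ 3` and a window `Λ'` of coordinate spreads
`≤ M` with `M + 1 ≤ L` (e.g. every window of extent `≤ L`), every translation + EOM window certificate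
(data exactly as in `homTorusSpinTwist_minEnergyOn_div_ge_of_window_certificate`) bounds, for EVERY
spin-dependent boundary twist `κ : Fin 2 → Fin 2 → U(1)` (one phase per direction and per species —
PP, AP, AA, any two-direction flux, any Shastry–Sutherland spin twist), the energy density of the
Peierls Hamiltonian `homHubbardSpinMag ((Int.castAddHom (ZMod L)).compLeft (Fin 2)) κ t U` of the
`L × L` torus in every sector
`(2n, S^z = 0)`: `c − Σ‖aₖ‖ + (Σ_σ μ_σ)(n/L² − ν) ≤ minEnergyOn (H_κ) (szSector 2n 0) / L²`.
[cite: ShastrySutherland1990] [cite: Han2020Bootstrap, §3] [cite: Lieb1994, eq. (1)] -/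
theorem coordSpinTwist_minEnergyOn_div_ge_of_window_certificate (L : ℕ) [NeZero L] (hL : 3 ≤ L)
    (t U : ℝ) (κt : Fin 2 → Fin 2 → Circle) {nh : ℕ} (hn : nh ≤ Fintype.card (FermionTorus 2 L))
    {Λ Λ' : Finset (Site 2)} (hΛ : Λ ⊆ Λ') {M : ℕ} (hM : M + 1 ≤ L)
    (hspread : ∀ x ∈ Λ', ∀ y ∈ Λ', ∀ i, |x i - y i| ≤ (M : ℤ))
    (hclosed : ∀ x ∈ Λ, ∀ i : Fin 2, x + unitVec i ∈ Λ' ∧ x - unitVec i ∈ Λ')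
    (h0 : thicken ({0} : Finset (Site 2)) 1 ⊆ Λ') (hz : (0 : Site 2) ∈ Λ')
    (μ : Fin 2 → ℝ) (ν : ℝ)
    {m : Type*} [Fintype m] [DecidableEq m] {Λm : Matrix m m ℂ} (hΛm : Λm.PosSemidef)
    (O : m → FermionOp Λ')
    {κ : Type*} (s : Finset κ) (B : κ → FermionOp Λ)
    {ι : Type*} (tt : Finset ι) (v : ι → Site 2) (hsh : ∀ l, shiftSet (v l) Λ ⊆ Λ') (Y : ι → FermionOp Λ)
    {γ : Type*} (u : Finset γ) (b : γ → ℂ) (cw : γ → List (Orb (PolySite Λ') × Bool))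
    (hcw : ∀ j ∈ u, ladderCharge (cw j) ≠ 0 ∨ ladderSpinCharge (cw j) ≠ 0)
    {δ : Type*} (ah : Finset δ) (dc : δ → ℝ) (V : δ → FermionOp Λ')
    {κ'' : Type*} (w : Finset κ'') (a : κ'' → ℂ) (word : κ'' → List (Orb (PolySite Λ') × Bool)) {c : ℝ}
    (hcert : fermionEmbed (PolySite.incl h0) ((hubbardFermionInteraction 2 t U).meanEnergyObs 1) -
        (c : ℂ) • (1 : FermionOp Λ') -
        ∑ σ : Fin 2, ((μ σ : ℝ) : ℂ) • (nAt 0 hz σ - ((ν : ℝ) : ℂ) • (1 : FermionOp Λ')) =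
      gramForm Λm O +
        (∑ k ∈ s, ((hubbardFermionInteraction 2 t U).localHamiltonian Λ' * fermionEmbed (PolySite.incl hΛ) (B k) -
            fermionEmbed (PolySite.incl hΛ) (B k) * (hubbardFermionInteraction 2 t U).localHamiltonian Λ') +
          ∑ l ∈ tt, (fermionEmbed (PolySite.incl (hsh l)) (fermionEmbed (PolySite.shiftEmb (v l) Λ) (Y l)) -
            fermionEmbed (PolySite.incl hΛ) (Y l)) +
          ∑ j ∈ u, b j • ladderWord (cw j)) +
        (∑ m' ∈ ah, ((dc m' : ℝ) : ℂ) • ((V m')ᴴ - V m') + ∑ k ∈ w, a k • ladderWord (word k))) :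
    c - ∑ k ∈ w, ‖a k‖ + (∑ σ : Fin 2, μ σ) * ((nh : ℝ) / (L : ℝ) ^ 2 - ν) ≤
      (homHubbardSpinMag ((Int.castAddHom (ZMod L)).compLeft (Fin 2)) (fun _ => κt) t U).minEnergyOn
          (szSector (2 * nh) 0) / (L : ℝ) ^ 2 := by
  have hInj' : Set.InjOn ((Int.castAddHom (ZMod L)).compLeft (Fin 2)) ↑Λ' :=
    injOn_coordHom_of_spread hM hspread
  have hd : Function.Injective (signedHop ((Int.castAddHom (ZMod L)).compLeft (Fin 2))) :=
    injective_signedHop_coordHom hL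
  exact homTorusSpinTwist_minEnergyOn_div_ge_of_window_certificate _ t U κt hd hn hΛ
    hclosed h0 hz hInj' μ ν hΛm O s B tt v hsh Y u b cw hcw ah dc V w a word hcert

/-- **Spin-blind / flux-only special case** (`κ i σ = κ' i`): every two-direction flux `(θx, θy)` of
the `L × L` torus, incl. `AA`. [cite: Lieb1994, eq. (1)] [cite: Han2020Bootstrap, §3] -/
theorem coordTwist_minEnergyOn_div_ge_of_window_certificate (L : ℕ) [NeZero L] (hL : 3 ≤ L)
    (t U : ℝ) (κ' : Fin 2 → Circle) {nh : ℕ} (hn : nh ≤ Fintype.card (FermionTorus 2 L))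
    {Λ Λ' : Finset (Site 2)} (hΛ : Λ ⊆ Λ') {M : ℕ} (hM : M + 1 ≤ L)
    (hspread : ∀ x ∈ Λ', ∀ y ∈ Λ', ∀ i, |x i - y i| ≤ (M : ℤ))
    (hclosed : ∀ x ∈ Λ, ∀ i : Fin 2, x + unitVec i ∈ Λ' ∧ x - unitVec i ∈ Λ')
    (h0 : thicken ({0} : Finset (Site 2)) 1 ⊆ Λ') (hz : (0 : Site 2) ∈ Λ')
    (μ : Fin 2 → ℝ) (ν : ℝ)
    {m : Type*} [Fintype m] [DecidableEq m] {Λm : Matrix m m ℂ} (hΛm : Λm.PosSemidef)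
    (O : m → FermionOp Λ')
    {κ : Type*} (s : Finset κ) (B : κ → FermionOp Λ)
    {ι : Type*} (tt : Finset ι) (v : ι → Site 2) (hsh : ∀ l, shiftSet (v l) Λ ⊆ Λ') (Y : ι → FermionOp Λ)
    {γ : Type*} (u : Finset γ) (b : γ → ℂ) (cw : γ → List (Orb (PolySite Λ') × Bool))
    (hcw : ∀ j ∈ u, ladderCharge (cw j) ≠ 0 ∨ ladderSpinCharge (cw j) ≠ 0)
    {δ : Type*} (ah : Finset δ) (dc : δ → ℝ) (V : δ → FermionOp Λ')
    {κ'' : Type*} (w : Finset κ'') (a : κ'' → ℂ) (word : κ'' → List (Orb (PolySite Λ') × Bool)) {c : ℝ}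
    (hcert : fermionEmbed (PolySite.incl h0) ((hubbardFermionInteraction 2 t U).meanEnergyObs 1) -
        (c : ℂ) • (1 : FermionOp Λ') -
        ∑ σ : Fin 2, ((μ σ : ℝ) : ℂ) • (nAt 0 hz σ - ((ν : ℝ) : ℂ) • (1 : FermionOp Λ')) =
      gramForm Λm O +
        (∑ k ∈ s, ((hubbardFermionInteraction 2 t U).localHamiltonian Λ' * fermionEmbed (PolySite.incl hΛ) (B k) -
            fermionEmbed (PolySite.incl hΛ) (B k) * (hubbardFermionInteraction 2 t U).localHamiltonian Λ') +
          ∑ l ∈ tt, (fermionEmbed (PolySite.incl (hsh l)) (fermionEmbed (PolySite.shiftEmb (v l) Λ) (Y l)) -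
            fermionEmbed (PolySite.incl hΛ) (Y l)) +
          ∑ j ∈ u, b j • ladderWord (cw j)) +
        (∑ m' ∈ ah, ((dc m' : ℝ) : ℂ) • ((V m')ᴴ - V m') + ∑ k ∈ w, a k • ladderWord (word k))) :
    c - ∑ k ∈ w, ‖a k‖ + (∑ σ : Fin 2, μ σ) * ((nh : ℝ) / (L : ℝ) ^ 2 - ν) ≤
      (homHubbardMag ((Int.castAddHom (ZMod L)).compLeft (Fin 2)) (fun _ => κ') t U).minEnergyOn
          (szSector (2 * nh) 0) / (L : ℝ) ^ 2 := by
  rw [← homHubbardSpinMag_const_spinBlind]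
  exact coordSpinTwist_minEnergyOn_div_ge_of_window_certificate L hL t U (fun i _ => κ' i) hn hΛ hM
    hspread hclosed h0 hz μ ν hΛm O s B tt v hsh Y u b cw hcw ah dc V w a word hcert

end CoordSpinTwist

end Summit.Ventures.CertifiedManyBodySolver.Rows

end
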